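import Literature.Computability.Complexity.HashBricks
import Literature.Computability.Complexity.StackBricksArith
import Literature.Computability.Complexity.EncodingFrames
import HarnessLib

/-!
# Fold bricks: clipped piece functions and the counted fold `acc := op ⟨acc, f ⟨x, 1ⁱ⟩⟩` in `FP`

Trunk `CplxCore`, toolkit in the `FP`-algebra style of `BrickAlgebra.lean` (records, `loopStep`,
`loopFn_mem_FP`) and `HashBricks.lean`. A machine written in that algebra repeats one pattern:
run an index `i = i₀, i₀ + 1, …` (in unary, `1ⁱ`) for a prescribed number of rounds and fold the
values `f ⟨x, 1ⁱ⟩` of a piece function into an accumulator with a binary operation `op` —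
concatenation (emit the pieces of a code), addition (a sum of products), multiplication (a
factorial). This file proves the pattern once:

* `Brick.clipF C f` — `f` with its output clipped to `C (|fstF z| + 1)` symbols: the clipped
  function satisfies the linear growth bound that `loopFn_mem_FP` asks of loop bodies *on every
  input*, and agrees with `f` wherever `f` is that short (`clipF_eq_self`), so that growth
  bookkeeping on malformed inputs is replaced by a length estimate on the intended ones;
* `Brick.foldBody op f`, `Brick.foldLoop op f p` — the loop on records `⟨x, ⟨cnt, ⟨1ⁱ, acc⟩⟩⟩`
  (binary countdown `cnt`, `p (|x|)` rounds available) with body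
  `⟨1ⁱ, acc⟩ ↦ ⟨1ⁱ⁺¹, op ⟨acc, f ⟨x, 1ⁱ⟩⟩⟩`; its model `Brick.foldAcc` (`foldLoop_apply`) and
  **`foldLoop_mem_FP`** (for `op` of additive growth and `f` of linear growth in the context);
* the three instances: `foldAcc_app` (concatenation `appF`, result `acc ++ ccat …` with the
  `ccat` of `EncodingFrames.lean`), `foldAcc_addFn` (sums, canonical numerals), `foldAcc_prodFn`
  (products); and the growth lemmas of `appF`, `addFn`, `prodFn` in the required shape;
* small bricks used with them: `Brick.ltLenF` (`[|u| < |v|]`, one-bit), `Brick.lastFalseF` /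
  `Brick.canonF` (the canonical numeral `encodeNat (decodeNat a)` of an arbitrary answer string
  `a`, `bitsToNat_canonF`), `Brick.lenBinF` (`encodeNat |w|`).

## References

* S. Arora, B. Barak, *Computational Complexity: A Modern Approach*, CUP 2009, §1.3 (polynomial
  time is closed under composition and polynomially bounded loops), §1.4.1 (clocked loops).
* T. Nipkow, G. Klein, *Concrete Semantics with Isabelle/HOL*, Springer 2014, §7.2 (loop rule
  with an invariant). (Standard; fully proved here.)
-/

namespace Literature.Computability.Complexity

open _root_.Computability Polynomial OracleCompose HashBricks Plumb

namespace Brick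

/-! ### Clipping a string function to linear size in its first field -/

/-- `clipF C f z = (f z) ↾ C (|fstF z| + 1)`: the output of `f`, clipped to linear size in the first
field of the argument. [folklore] -/
noncomputable def clipF (C : ℕ) (f : List Bool → List Bool) : List Bool → List Bool :=
  takeFn ∘ fanoutFn (polyFn (Polynomial.C C * (X + 1)) ∘ fstF) f

/-- Value of `clipF`. [folklore] -/
theorem clipF_apply (C : ℕ) (f : List Bool → List Bool) (z : List Bool) :
    clipF C f z = (f z).take (C * ((fstF z).length + 1)) := by
  simp [clipF]

/-- The clipped function has linear size in the first field, on every input. [folklore] -/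
theorem length_clipF_le (C : ℕ) (f : List Bool → List Bool) (z : List Bool) :
    (clipF C f z).length ≤ C * ((fstF z).length + 1) := by
  rw [clipF_apply]; exact List.length_take_le _ _

/-- Clipping does not lengthen. [folklore] -/
theorem length_clipF_le' (C : ℕ) (f : List Bool → List Bool) (z : List Bool) :
    (clipF C f z).length ≤ (f z).length := by
  rw [clipF_apply]; exact List.length_take_le' _ _

/-- **Clipping is the identity on short outputs.** [folklore] -/
theorem clipF_eq_self {C : ℕ} {f : List Bool → List Bool} {z : List Bool}
    (h : (f z).length ≤ C * ((fstF z).length + 1)) : clipF C f z = f z := by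
  rw [clipF_apply, List.take_of_length_le h]

/-- `clipF C f ∈ FP` for `f ∈ FP`. [folklore] -/
theorem clipF_mem_FP (C : ℕ) {f : List Bool → List Bool} (hf : f ∈ FP) : clipF C f ∈ FP :=
  comp_mem_FP takeFn_mem_FP (fanoutFn_mem_FP (comp_mem_FP (polyFn_mem_FP _) fstF_mem_FP) hf)

/-! ### The generic fold loop -/

/-- **Body of the fold loop** on records `z = ⟨x, ⟨cnt, ⟨u, acc⟩⟩⟩`: the new state
`⟨1 u, op ⟨acc, f ⟨x, u⟩⟩⟩` (the index `u = 1ⁱ` is bumped, the piece `f ⟨x, 1ⁱ⟩` folded in).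
[cite: AroraBarak2009, §1.3 (bounded loops)] -/
noncomputable def foldBody (op f : List Bool → List Bool) : List Bool → List Bool :=
  fanoutFn (List.cons true ∘ nthF 2) (op ∘ fanoutFn (sndPow 2) (f ∘ fanoutFn (nthF 0) (nthF 2)))

/-- `foldBody` on a record. [folklore] -/
@[simp] theorem foldBody_apply (op f : List Bool → List Bool) (x cnt u acc : List Bool) :
    foldBody op f (boolPair x (boolPair cnt (boolPair u acc))) =
      boolPair (true :: u) (op (boolPair acc (f (boolPair x u)))) := by
  simp [foldBody]

/-- `foldBody op f ∈ FP` for `op, f ∈ FP`. [folklore] -/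
theorem foldBody_mem_FP {op f : List Bool → List Bool} (hop : op ∈ FP) (hf : f ∈ FP) :
    foldBody op f ∈ FP :=
  fanoutFn_mem_FP (comp_mem_FP (cons_mem_FP true) (nthF_mem_FP 2))
    (comp_mem_FP hop (fanoutFn_mem_FP (sndPow_mem_FP 2) (comp_mem_FP hf (fanoutFn_mem_FP (nthF_mem_FP 0) (nthF_mem_FP 2)))))

/-- **Growth of the fold body**: for `op` of additive growth `|op ⟨a, b⟩| ≤ |a| + |b| + d` and `f`
of linear growth `|f w| ≤ C (|fstF w| + 1)` (both on every input), the body satisfies the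
hypothesis of `loopFn_mem_FP` with constant `C + d + 4`. [folklore] -/
theorem length_foldBody_le {op f : List Bool → List Bool} {d C : ℕ}
    (hop : ∀ w, (op w).length ≤ (fstF w).length + (sndF w).length + d)
    (hf : ∀ w, (f w).length ≤ C * ((fstF w).length + 1)) (z : List Bool) :
    (foldBody op f z).length ≤ (sndPow 1 z).length + (C + d + 4) * ((fstF z).length + 1) := by
  rw [foldBody, length_fanoutFn]
  have h1 := length_nthF_succ_add_sndPow_succ_le 1 z
  have h2 := hop (fanoutFn (sndPow 2) (f ∘ fanoutFn (nthF 0) (nthF 2)) z)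
  have h3 := hf (fanoutFn (nthF 0) (nthF 2) z)
  simp only [Function.comp_apply, fanoutFn_apply, fstF_boolPair, sndF_boolPair, List.length_cons,
    nthF_zero] at h2 h3 ⊢
  nlinarith [h1, h2, h3, Nat.zero_le C, Nat.zero_le (fstF z).length]

/-- **The model of the fold**: `k` rounds from index `i` and accumulator `acc`. [folklore] -/
def foldAcc (op f : List Bool → List Bool) (x : List Bool) : ℕ → ℕ → List Bool → List Bool
  | _, 0, acc => acc
  | i, k + 1, acc => foldAcc op f x (i + 1) k (op (boolPair acc (f (boolPair x (ones i)))))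

/-- No rounds. [folklore] -/
@[simp] theorem foldAcc_zero (op f : List Bool → List Bool) (x : List Bool) (i : ℕ) (acc : List Bool) :
    foldAcc op f x i 0 acc = acc := rfl

/-- One more round, peeled at the front. [folklore] -/
theorem foldAcc_succ (op f : List Bool → List Bool) (x : List Bool) (i k : ℕ) (acc : List Bool) :
    foldAcc op f x i (k + 1) acc = foldAcc op f x (i + 1) k (op (boolPair acc (f (boolPair x (ones i))))) := rfl

/-- One more round, peeled at the back. [folklore] -/
theorem foldAcc_succ' (op f : List Bool → List Bool) (x : List Bool) : ∀ (i k : ℕ) (acc : List Bool),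
    foldAcc op f x i (k + 1) acc = op (boolPair (foldAcc op f x i k acc) (f (boolPair x (ones (i + k)))))
  | i, 0, acc => by simp [foldAcc]
  | i, k + 1, acc => by
    rw [foldAcc_succ, foldAcc_succ' op f x (i + 1) k, foldAcc_succ, show i + 1 + k = i + (k + 1) by omega]

/-- The fold depends only on the pieces it folds. [folklore] -/
theorem foldAcc_congr {op f g : List Bool → List Bool} {x : List Bool} : ∀ {i k : ℕ} {acc : List Bool},
    (∀ j, i ≤ j → j < i + k → f (boolPair x (ones j)) = g (boolPair x (ones j))) →
      foldAcc op f x i k acc = foldAcc op g x i k acc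
  | i, 0, acc, _ => rfl
  | i, k + 1, acc, h => by
    rw [foldAcc_succ, foldAcc_succ, h i le_rfl (by omega)]
    exact foldAcc_congr fun j hj hj' => h j (by omega) (by omega)

/-- The counted-loop model of `foldBody` is `foldAcc`, the index ending at `1^{i+k}`. [folklore] -/
theorem loopModel_foldBody (op f : List Bool → List Bool) (x : List Bool) : ∀ (k i : ℕ) (acc : List Bool),
    loopModel (foldBody op f) x k (boolPair (ones i) acc) = boolPair (ones (i + k)) (foldAcc op f x i k acc)
  | 0, i, acc => by simp [loopModel]
  | k + 1, i, acc => by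
    rw [loopModel, foldBody_apply, show true :: ones i = ones (i + 1) by simp [ones, List.replicate_succ],
      loopModel_foldBody op f x k (i + 1), foldAcc_succ]
    congr 2; omega

/-- **The fold loop**: `p (|x|)` rounds of `loopStep (foldBody op f)` on `⟨x, ⟨cnt, ⟨u, acc⟩⟩⟩`.
[cite: AroraBarak2009, §1.3 (bounded loops), §1.4.1] -/
noncomputable def foldLoop (op f : List Bool → List Bool) (p : Polynomial ℕ) : List Bool → List Bool :=
  fun z => (loopStep (foldBody op f))^[p.eval (fstF z).length] z

/-- **Semantics of the fold loop**: with the countdown `k ≤ p (|x|)`, from index `1ⁱ` and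
accumulator `acc` the loop ends at countdown `0`, index `1^{i+k}` and accumulator
`foldAcc op f x i k acc`. [folklore] -/
theorem foldLoop_apply (op f : List Bool → List Bool) {p : Polynomial ℕ} {x : List Bool} {k : ℕ}
    (hk : k ≤ p.eval x.length) (i : ℕ) (acc : List Bool) :
    foldLoop op f p (boolPair x (boolPair (encodeNat k) (boolPair (ones i) acc))) =
      boolPair x (boolPair [] (boolPair (ones (i + k)) (foldAcc op f x i k acc))) := by
  rw [foldLoop, fstF_boolPair, iterate_loopStep _ x k _ _ hk, loopModel_foldBody]

/-- **The fold loop is in `FP`** for `op ∈ FP` of additive growth and `f ∈ FP` of linear growth in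
its first field (e.g. a clipped function, `length_clipF_le`). [cite: AroraBarak2009, §1.3 (bounded loops), §1.4.1] -/
theorem foldLoop_mem_FP {op f : List Bool → List Bool} {d C : ℕ} (hop : op ∈ FP)
    (hopg : ∀ w, (op w).length ≤ (fstF w).length + (sndF w).length + d) (hf : f ∈ FP)
    (hfg : ∀ w, (f w).length ≤ C * ((fstF w).length + 1)) (p : Polynomial ℕ) : foldLoop op f p ∈ FP :=
  loopFn_mem_FP (foldBody_mem_FP hop hf) (length_foldBody_le hopg hfg) p

/-- The fold loop with a clipped piece function is in `FP`. [folklore] -/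
theorem foldLoop_clipF_mem_FP {op f : List Bool → List Bool} {d : ℕ} (C : ℕ) (hop : op ∈ FP)
    (hopg : ∀ w, (op w).length ≤ (fstF w).length + (sndF w).length + d) (hf : f ∈ FP) (p : Polynomial ℕ) :
    foldLoop op (clipF C f) p ∈ FP :=
  foldLoop_mem_FP hop hopg (clipF_mem_FP C hf) (length_clipF_le C f) p

/-- **Unclipping**: if the pieces actually folded are short, the clipped fold is the fold. [folklore] -/
theorem foldAcc_clipF {op f : List Bool → List Bool} {C : ℕ} {x : List Bool} {i k : ℕ} {acc : List Bool}
    (h : ∀ j, i ≤ j → j < i + k → (f (boolPair x (ones j))).length ≤ C * (x.length + 1)) :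
    foldAcc op (clipF C f) x i k acc = foldAcc op f x i k acc :=
  foldAcc_congr fun j hj hj' => clipF_eq_self (by rw [fstF_boolPair]; exact h j hj hj')

/-! ### Instances: concatenation, sums, products -/

/-- Concatenation of the two fields: `appF ⟨a, b⟩ = a ++ b` (total: `fstF z ++ sndF z`; the transducer
`concatFn` of `CookReducibilityTransitive.lean` has this value on pairs but no stated value on malformed
strings, which the growth bookkeeping needs). Unrelated to the replay-step function
`OracleComposition.appF` of `OracleCompositionMachine.lean`. [folklore] -/
def appF : List Bool → List Bool := fun z => fstF z ++ sndF z

/-- `appF` on a pair. [folklore] -/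
@[simp] theorem appF_boolPair (a b : List Bool) : appF (boolPair a b) = a ++ b := by simp [appF]

/-- `appF ∈ FP`. [folklore] -/
theorem appF_mem_FP : appF ∈ FP := append_mem_FP fstF_mem_FP sndF_mem_FP

/-- Growth of `appF`: exactly additive. [folklore] -/
theorem length_appF_le (w : List Bool) : (appF w).length ≤ (fstF w).length + (sndF w).length + 0 := by
  simp [appF]

/-- **The concatenation fold**: `acc`, then the pieces `f ⟨x, 1ⁱ⟩, …, f ⟨x, 1^{i+k-1}⟩` (a `ccat`). [folklore] -/
theorem foldAcc_appF (f : List Bool → List Bool) (x : List Bool) : ∀ (k i : ℕ) (acc : List Bool),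
    foldAcc appF f x i k acc = acc ++ ccat (fun j => f (boolPair x (ones (i + j)))) k
  | 0, i, acc => by simp
  | k + 1, i, acc => by
    rw [foldAcc_succ', foldAcc_appF f x k i acc, appF_boolPair, ccat_succ, List.append_assoc]

/-- The size of a sum: `|bin (a + b)| ≤ |u| + |v| + 1` for numerals `u, v` of `a, b`. [folklore] -/
theorem length_encodeNat_add_le (u v : List Bool) :
    (encodeNat (bitsToNat u + bitsToNat v)).length ≤ u.length + v.length + 1 := by
  rw [TM2Pass.length_encodeNat_eq_size]
  have hu : bitsToNat u < 2 ^ u.length := bitsToNat_lt u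
  have hv : bitsToNat v < 2 ^ v.length := bitsToNat_lt v
  rw [Nat.size_le]
  have h1 : 2 ^ u.length ≤ 2 ^ (u.length + v.length) := Nat.pow_le_pow_right (by norm_num) (by omega)
  have h2 : 2 ^ v.length ≤ 2 ^ (u.length + v.length) := Nat.pow_le_pow_right (by norm_num) (by omega)
  rw [pow_succ]
  omega

/-- Growth of `addFn`: additive plus one carry symbol. [folklore] -/
theorem length_addFn_le (w : List Bool) : (addFn w).length ≤ (fstF w).length + (sndF w).length + 1 := by
  have : addFn w = encodeNat (bitsToNat (fstF w) + bitsToNat (sndF w)) := rfl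
  rw [this]; exact length_encodeNat_add_le _ _

/-- Growth of `prodFn`: additive. [folklore] -/
theorem length_prodFn_le (w : List Bool) : (prodFn w).length ≤ (fstF w).length + (sndF w).length + 0 := by
  have : prodFn w = encodeNat (bitsToNat (fstF w) * bitsToNat (sndF w)) := rfl
  rw [this]; exact length_encodeNat_mul_le _ _

/-- **The sum fold**: from the numeral of `a`, the canonical numeral of `a + Σ_{j<k} ⟦f ⟨x, 1^{i+j}⟩⟧`. [folklore] -/
theorem foldAcc_addFn (f : List Bool → List Bool) (x : List Bool) : ∀ (k i a : ℕ),
    foldAcc addFn f x i k (encodeNat a) =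
      encodeNat (a + ∑ j ∈ Finset.range k, bitsToNat (f (boolPair x (ones (i + j)))))
  | 0, i, a => by simp
  | k + 1, i, a => by
    rw [foldAcc_succ', foldAcc_addFn f x k i a, addFn_boolPair, bitsToNat_encodeNat, Finset.sum_range_succ,
      Nat.add_assoc]

/-- **The product fold**: from the numeral of `a`, the canonical numeral of `a · Π_{j<k} ⟦f ⟨x, 1^{i+j}⟩⟧`. [folklore] -/
theorem foldAcc_prodFn (f : List Bool → List Bool) (x : List Bool) : ∀ (k i a : ℕ),
    foldAcc prodFn f x i k (encodeNat a) =
      encodeNat (a * ∏ j ∈ Finset.range k, bitsToNat (f (boolPair x (ones (i + j)))))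
  | 0, i, a => by simp
  | k + 1, i, a => by
    rw [foldAcc_succ', foldAcc_prodFn f x k i a, prodFn_boolPair, bitsToNat_encodeNat, Finset.prod_range_succ,
      Nat.mul_assoc]

/-! ### Small bricks: length comparison, the binary length, canonical numerals -/

/-- **`ltLenF ⟨u, v⟩ = [|u| < |v|]`** (the length test `lenLeFn X` on `⟨v, 1 u⟩`), a one-bit condition. [folklore] -/
noncomputable def ltLenF : List Bool → List Bool := lenLeFn X ∘ fanoutFn sndF (List.cons true ∘ fstF)

/-- Value of `ltLenF` on a pair. [folklore] -/
@[simp] theorem ltLenF_boolPair (u v : List Bool) : ltLenF (boolPair u v) = [decide (u.length < v.length)] := by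
  simp only [ltLenF, Function.comp_apply, fanoutFn_apply, sndF_boolPair, fstF_boolPair, lenLeFn_boolPair,
    List.length_cons, eval_X]
  rfl

/-- `ltLenF` is one-bit. [folklore] -/
theorem oneBit_ltLenF : OneBit ltLenF := fun w => by
  rcases lenLeFn_eq_or X (fanoutFn sndF (List.cons true ∘ fstF) w) with h | h
  · exact ⟨true, h⟩
  · exact ⟨false, h⟩

/-- `ltLenF ∈ FP`. [folklore] -/
theorem ltLenF_mem_FP : ltLenF ∈ FP :=
  comp_mem_FP (lenLeFn_mem_FP X) (fanoutFn_mem_FP sndF_mem_FP (comp_mem_FP (cons_mem_FP true) fstF_mem_FP))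

/-- **`lenBinF w = encodeNat |w|`** (the number of `1`s of `1^{|w|}`). Twin of `ShorFP.lenBinF`
(`Cryptography/ShorPerfectPowerFP.lean`, a counting loop), which sits on top of the Shor development and
is not importable into the toolkit. [folklore] -/
noncomputable def lenBinF : List Bool → List Bool := popCountFn ∘ onesFn

/-- Value of `lenBinF`. [folklore] -/
@[simp] theorem lenBinF_apply (w : List Bool) : lenBinF w = encodeNat w.length := by
  simp [lenBinF, onesFn, unaryEncodeNat_eq_replicate]

/-- `lenBinF ∈ FP`. [folklore] -/
theorem lenBinF_mem_FP : lenBinF ∈ FP := comp_mem_FP popCountFn_mem_FP onesFn_mem_FP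

/-- **The test "nonempty and ending in `0`"** (i.e. *not* a canonical numeral), one-bit:
the symbol at position `|tail w|` of `w` compared with `0`. [folklore] -/
noncomputable def lastFalseF : List Bool → List Bool :=
  eqPairFn ∘ fanoutFn (bitAtFn ∘ fanoutFn List.tail id) (fun _ => [false])

/-- `lastFalseF w = [true]` iff `w` is nonempty and ends in `0`. [folklore] -/
theorem lastFalseF_apply (w : List Bool) : lastFalseF w = [decide (w.getLast? = some false)] := by
  simp only [lastFalseF, Function.comp_apply, fanoutFn_apply, id, eqPairFn_boolPair, bitAtFn_boolPair,
    List.length_tail]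
  cases w.eq_nil_or_concat with
  | inl h => subst h; simp
  | inr h =>
    obtain ⟨l, b, rfl⟩ := h
    simp

/-- `lastFalseF` is one-bit. [folklore] -/
theorem oneBit_lastFalseF : OneBit lastFalseF := fun w => by
  rcases eqPairFn_eq_or (fanoutFn (bitAtFn ∘ fanoutFn List.tail id) (fun _ => [false]) w) with h | h
  · exact ⟨true, h⟩
  · exact ⟨false, h⟩

/-- `lastFalseF ∈ FP`. [folklore] -/
theorem lastFalseF_mem_FP : lastFalseF ∈ FP :=
  comp_mem_FP eqPairFn_mem_FP (fanoutFn_mem_FP (comp_mem_FP bitAtFn_mem_FP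
    (fanoutFn_mem_FP PRelSigma.tail_mem_FP OracleCompose.id_mem_FP)) (const_mem_FP _))

/-- **The canonical numeral of an arbitrary string read by `decodeNat`**: append a `1` when the
string is nonempty and ends in `0` (Mathlib's `decodePosNum` reads a missing final `1`), otherwise
keep it. Same function as `NegCNF.canon` (`NegCNFTranscoder.lean`), `ShorOrdPost.canonBits` and the
brick `ShorFP.canonF` (`Cryptography/ShorStepFP.lean`); restated in the toolkit namespace because those
files sit on top of the tautology / Shor developments and are not importable here. [folklore] -/
noncomputable def canonF : List Bool → List Bool := iteFn lastFalseF (fun w => w ++ [true]) id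

/-- `canonF ∈ FP`. [folklore] -/
theorem canonF_mem_FP : canonF ∈ FP :=
  iteFn_mem_FP lastFalseF_mem_FP (append_mem_FP OracleCompose.id_mem_FP (const_mem_FP _)) OracleCompose.id_mem_FP

/-- Value of `canonF`. [folklore] -/
theorem canonF_apply (w : List Bool) : canonF w = if w.getLast? = some false then w ++ [true] else w := by
  rw [canonF, iteFn_apply (lastFalseF_apply w)]
  by_cases h : w.getLast? = some false <;> simp [h]

/-- `canonF` lengthens by at most one symbol. [folklore] -/
theorem length_canonF_le (w : List Bool) : (canonF w).length ≤ w.length + 1 := by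
  rw [canonF_apply]; split_ifs <;> simp

/-- `decodePosNum` reads a nonempty numeral ending in `0` as if a final `1` were appended. [folklore] -/
theorem decodePosNum_append_true_of_last : ∀ l : List Bool, l.getLast? = some false →
    decodePosNum l = decodePosNum (l ++ [true])
  | [], h => by simp at h
  | [false], _ => rfl
  | [true], h => by simp at h
  | false :: b :: l, h => by
    have h' : (b :: l).getLast? = some false := by rwa [List.getLast?_cons_cons] at h
    rw [List.cons_append, decodePosNum, decodePosNum, decodePosNum_append_true_of_last (b :: l) h']
  | true :: b :: l, h => by
    have h' : (b :: l).getLast? = some false := by rwa [List.getLast?_cons_cons] at h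
    rw [List.cons_append, decodePosNum, decodePosNum, if_neg (by simp), if_neg (by simp),
      decodePosNum_append_true_of_last (b :: l) h']

/-- `decodeNat` reads every string as its canonical form. [folklore] -/
theorem decodeNat_canonF (w : List Bool) : decodeNat (canonF w) = decodeNat w := by
  rw [canonF_apply]
  split_ifs with h
  · have hne : w ≠ [] := by rintro rfl; simp at h
    unfold decodeNat decodeNum
    rw [if_neg (by simp), if_neg hne, decodePosNum_append_true_of_last w h]
  · rfl

/-- `canonF w` is a canonical numeral. [folklore] -/
theorem isCanonicalNum_canonF (w : List Bool) : IsCanonicalNum (canonF w) := by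
  rw [canonF_apply]
  split_ifs with h
  · exact Or.inr (by simp)
  · unfold IsCanonicalNum
    cases w.eq_nil_or_concat with
    | inl h0 => exact Or.inl h0
    | inr h0 =>
      obtain ⟨l, b, rfl⟩ := h0
      cases b
      · simp at h
      · exact Or.inr (by simp)

/-- **`canonF w = encodeNat (decodeNat w)`.** [folklore] -/
theorem canonF_eq_encodeNat_decodeNat (w : List Bool) : canonF w = encodeNat (decodeNat w) := by
  rw [← decodeNat_canonF, encodeNat_decodeNat (isCanonicalNum_canonF w)]

/-- **`⟦canonF w⟧ = decodeNat w`.** [folklore] -/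
theorem bitsToNat_canonF (w : List Bool) : bitsToNat (canonF w) = decodeNat w := by
  rw [canonF_eq_encodeNat_decodeNat, bitsToNat_encodeNat]

/-! ### Numerals of strings of `1`s and the ceiling of a division by `2^m` -/

/-- `⟦1ᵐ⟧ = 2^m - 1`. (Twin of `MCSPVerif.bitsToNat_ones`, `MetaComplexity/MCSPProofs.lean`, a leaf
file not importable into the toolkit.) [folklore] -/
theorem bitsToNat_ones (m : ℕ) : bitsToNat (ones m) = 2 ^ m - 1 := by
  have h := TM2Pass.bitsToNat_ones_append_succ m []
  simp only [List.append_nil, bitsToNat_nil, Nat.zero_add, Nat.mul_one] at h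
  have : 0 < 2 ^ m := Nat.two_pow_pos m
  change bitsToNat (List.replicate m true) = _
  omega

/-- `⟦w ⇂ m⟧ = ⟦w⟧ / 2^m` (dropping low bits is division). (Twin of `GridSAW.bitsToNat_drop`,
`Barriers/CriticalPhenomena/GridSAWCountingSharpPCompleteProofs.lean`, a leaf file not importable into
the toolkit.) [folklore] -/
theorem bitsToNat_drop (w : List Bool) (m : ℕ) : bitsToNat (w.drop m) = bitsToNat w / 2 ^ m := by
  conv_rhs => rw [← List.take_append_drop m w, bitsToNat_append]
  rcases le_or_gt m w.length with hm | hm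
  · rw [List.length_take_of_le hm, Nat.add_mul_div_left _ _ (Nat.two_pow_pos m),
      Nat.div_eq_of_lt ((bitsToNat_lt _).trans_le (Nat.pow_le_pow_right (by norm_num) (by simp [hm]))),
      Nat.zero_add]
  · rw [List.drop_eq_nil_of_le hm.le, bitsToNat_nil, Nat.mul_zero, Nat.add_zero,
      Nat.div_eq_of_lt ((bitsToNat_lt _).trans_le (Nat.pow_le_pow_right (by norm_num)
        (by simp only [List.length_take]; omega)))]

/-- **Ceiling division by a power of two on numerals**: `⟦(bin (K + (2^m - 1))) ⇂ m⟧ = ⌈K / 2^m⌉`,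
written as `(K + 2^m - 1) / 2^m`. [folklore] -/
theorem ceilDiv_two_pow_eq (K m : ℕ) : (K + (2 ^ m - 1)) / 2 ^ m = (K + 2 ^ m - 1) / 2 ^ m := by
  rw [← Nat.add_sub_assoc Nat.one_le_two_pow]

end Brick

end Literature.Computability.Complexity
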